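import Summits.BirchSwinnertonDyer.BirchSwinnertonDyer.Theorems.ByReductionTypeAtTwoOrdIsogenyTransport
import HarnessLib

/-!
# The EISENSTEIN HALF of the `2`-adic main conjecture is an isogeny-class statement at analytic rank `0`
# (route ByReductionTypeAtTwo / TwoAdicConverse, shared crux `OrdEisensteinHalfAtTwo` = item
# stmt-BirchSwinnertonDyer-19272; seat bsd-2adic-ord-3, GEN 3)

HONEST FRAMING (cell `bsd-2adic`, HUMAN RULINGS D-0036/D-0074): THEOREMS ONLY — no definition, no named
fact, nothing asserted, closes nothing. PUBLISHED inputs displayed: Kato 17.4 (1)(2) AT `2` at both members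
(`h17`, `h17'`), Greenberg 4.1 AT `2` at both (`hEC`, `hEC'`), modularity, GZK, Cassels.

WHAT. `…OrdIsogenyTransport` moved the Eisenstein leaf `X5.O1.MainConjectureEisensteinDivisibilityAtTwo`
along an isogeny only TOGETHER with the Kato half at the source. Here the Eisenstein half moves ALONE:
by GEN 0's rank-free reading `eisensteinAtDatum_iff_lam_le_and_mu_le_slack` the clause
`∃ h ∈ Λ, ι f_X = ι h·ϖ·L₂` at a datum is `λ(L₀) ≤ λ(X) ∧ μ(L₀) ≤ μ(X) + j` (`ι L₀ = 2ʲ·ϖ·L₂`); the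
`λ`-clause is an isogeny invariant for free (`λ(X)` by `X2.IsogenyLambdaInvariant`, `λ(L₀)` by the
rescaling lemma `lam_eq_of_iwasawaToPowerSeries_eq_C_mul` below), and the `μ`-clause moves by the
`μ`-SHIFT LAW at analytic rank `0` (`mu_add_padicValRat_eq_of_isIsogenous`). Net:
`mainConjectureEisensteinDivisibilityAtTwo_of_isIsogenous` — on K4's rank-`0` good-ordinary domain each of
the three typed statements {Kato half, Eisenstein half, `2`-adic MC} is an ISOGENY-CLASS INVARIANT, so a
certificate / theorem at ONE member of a ℚ-isogeny class serves every member (∀-closed: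
`eisensteinAtTwo_isogenyInvariant`).

References: R. Greenberg, LNM 1716 (1999), §1 p. 64, Thm. 4.1 (p. 102), §5 p. 175; R. Greenberg, V. Vatsal,
Invent. Math. 142 (2000), §2 p. 28; C. Skinner, E. Urban, Invent. Math. 195 (2014), Conj. 3.6.8 (p odd).
-/

set_option autoImplicit false
set_option linter.dupNamespace false

noncomputable section

open scoped Classical MatrixGroups ModularForm

open CongruenceSubgroup WeierstrassCurve Literature.NumberTheory.EllipticCurves
  Literature.NumberTheory.EllipticCurves.ModularForms Literature.NumberTheory.EllipticCurves.Rank1Residual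
  Literature.NumberTheory.EllipticCurves.Rank1Residual.Typed
  Summit.BirchSwinnertonDyer.Rank1Residual.X1.MuLambda
  Summit.BirchSwinnertonDyer.Rank1Residual.X1.MuPart
  Summit.BirchSwinnertonDyer.Rank1Residual.X1.ParitySqueeze
  Summit.BirchSwinnertonDyer.Rank1Residual Summit.BirchSwinnertonDyer.Rank1Residual.X5
  Summit.BirchSwinnertonDyer.BirchSwinnertonDyer.Theorems.EisensteinShaCurrency
  Summit.BirchSwinnertonDyer.BirchSwinnertonDyer.Theorems.LambdaConstPinch
  Summit.BirchSwinnertonDyer.Rank1Residual.Additive.TameBranchLambdaParity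
  Summit.BirchSwinnertonDyer.Rank1Residual.Additive

universe u

namespace Summit.BirchSwinnertonDyer.BirchSwinnertonDyer.Theorems.IsogenyMuShift

/-! ## §1 Rescaling preserves `λ` -/

section Rescale

variable {p : ℕ} [Fact p.Prime]

/-- **Rescaling preserves `λ`.** `G, L ∈ Λ ∖ 0`, `x ∈ ℚ_p ∖ 0`, `ι L = x · ι G`: `λ(L) = λ(G)` (indeed
`L = C(x p^{μ(G)}) · pfree G`). [cite: Washington1997, §7.1 (Weierstrass preparation)] -/
theorem lam_eq_of_iwasawaToPowerSeries_eq_C_mul {G L : IwasawaAlgebra p} (hG : G ≠ 0) (hL : L ≠ 0)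
    {x : ℚ_[p]} (hx : x ≠ 0)
    (h : iwasawaToPowerSeries p L = PowerSeries.C x * iwasawaToPowerSeries p G) : lam L = lam G := by
  have hp : (p : ℚ_[p]) ≠ 0 := by exact_mod_cast (Fact.out : p.Prime).ne_zero
  obtain ⟨hnn, -⟩ := mu_eq_of_iwasawaToPowerSeries_eq_C_mul hG hL hx h
  set y : ℚ_[p] := x * (p : ℚ_[p]) ^ mu G with hy
  have hy0 : y ≠ 0 := mul_ne_zero hx (pow_ne_zero _ hp)
  have hyval : y.valuation = x.valuation + mu G := by
    rw [hy, Padic.valuation_mul hx (pow_ne_zero _ hp), Padic.valuation_pow, Padic.valuation_p]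
    ring
  have hynorm : ‖y‖ ≤ 1 := by rw [Padic.norm_le_one_iff_val_nonneg, hyval]; exact hnn
  let y₀ : ℤ_[p] := ⟨y, hynorm⟩
  have hy₀c : (y₀ : ℚ_[p]) = y := rfl
  have hy₀0 : y₀ ≠ 0 := by
    intro h0
    apply hy0
    rw [← hy₀c, h0]
    rfl
  have hL' : iwasawaToPowerSeries p L = PowerSeries.C y * iwasawaToPowerSeries p (pfree G) := by
    rw [h, TameBranchAnalyticSha.iota_eq_C_pow_mu_mul_iota_pfree G, ← mul_assoc, ← map_mul]
  have hLeq : L = PowerSeries.C y₀ * pfree G := by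
    apply iwasawaToPowerSeries_injective p
    simp only [map_mul, iwasawaToPowerSeries_C, hL', hy₀c]
  have hC0 : (PowerSeries.C y₀ : IwasawaAlgebra p) ≠ 0 := by
    rw [Ne, ← map_zero (PowerSeries.C (R := ℤ_[p])), PowerSeries.C_injective.eq_iff]; exact hy₀0
  rw [hLeq, lam_mul hC0 (pfree_ne_zero hG), lam_C hy₀0, zero_add, (mu_pfree_eq_zero_and_lam_pfree_eq hG).2]

end Rescale

/-! ## §2 The Eisenstein half transports along an isogeny at analytic rank `0` -/

section Eisenstein

variable {W W' : WeierstrassCurve ℚ} [W.IsElliptic] [W'.IsElliptic] [W.IsGloballyMinimal]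
  [W'.IsGloballyMinimal]

/-- **THE EISENSTEIN HALF TRANSPORTS ALONG ISOGENIES (typed statement, analytic rank `0`) — alone,
without the Kato half.** `W ∼ W'` ℚ-isogenous globally minimal with `N_W = N_{W'}`, `W` of analytic
rank `0`; PUB: Kato 17.4 (1)(2) AT `2` at both, Greenberg 4.1 AT `2` at both, modularity, GZK, Cassels.
IF `X5.O1.MainConjectureEisensteinDivisibilityAtTwo W'` (the leaf of crux `OrdEisensteinHalfAtTwo` at
`W'`) THEN the same at `W`. Proof: at a datum the clause is `λ(L₀) ≤ λ(X) ∧ μ(L₀) ≤ μ(X) + j`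
(`eisensteinAtDatum_iff_lam_le_and_mu_le_slack`, GEN 0); `λ(X)`, `λ(L₀)` are isogeny/rescaling
invariants; `μ(L₀) − j − μ(X) = ord₂ ϖ + μ(L₂) − μ(X)` is an isogeny invariant by the `μ`-shift law.
[cite: SkinnerUrban2014, Conj. 3.6.8 (p. 45) (shape; p odd in print)] [cite: GreenbergVatsal2000, §2 p. 28]
[cite: GreenbergLNM1716, §1 p. 64, Thm. 4.1 (p. 102) and §5 p. 175] [cite: Kato2004Asterisque, Thm. 17.4 (1)(2) (p. 273)] -/
theorem mainConjectureEisensteinDivisibilityAtTwo_of_isIsogenous (hCassels : bsdRHS_eq_of_isIsogenous)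
    (hmod : nonempty_modularParametrizationData) (hGZK : rank_eq_analyticRank_of_analyticRank_le_one)
    (hiso : IsIsogenous W W') (hN : W.conductorNorm ℤ = W'.conductorNorm ℤ)
    (h17 : ∀ [NeZero (W.conductorNorm ℤ)] (f : CuspForm (Gamma0 (W.conductorNorm ℤ)) 2),
      kato_divisibility_allPrimes W 2 (f := f))
    (h17' : ∀ [NeZero (W'.conductorNorm ℤ)] (f : CuspForm (Gamma0 (W'.conductorNorm ℤ)) 2),
      kato_divisibility_allPrimes W' 2 (f := f))
    (hEC : O1.TwoAdicEulerCharRankZero W 0) (hEC' : O1.TwoAdicEulerCharRankZero W' 0)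
    (hr : W.analyticRank = 0) (hE' : O1.MainConjectureEisensteinDivisibilityAtTwo W') :
    O1.MainConjectureEisensteinDivisibilityAtTwo W := by
  intro κ γ hκ hγ hγ' hord _ f hf ϖ hϖ D fX hchar
  haveI : NeZero (W'.conductorNorm ℤ) := ⟨(W'.conductorNorm_pos_holds).ne'⟩
  haveI : Module.Finite (IwasawaAlgebra 2) D.X := D.module_finite_holds hγ
  have hL : W.entireLFunction 1 ≠ 0 := entireLFunction_one_ne_zero_of_analyticRank_eq_zero hmod W hr
  have hord' : IsOrdinaryAt W' 2 := isOrdinaryAt_of_isIsogenous hiso hord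
  have hα : unitRoot W' 2 = unitRoot W 2 := unitRoot_eq_of_isIsogenous hiso hord
  have hX : D.IsTorsion := (h17 f κ γ hκ hγ hγ' hord hf D).1
  have hϖ0 : ϖ ≠ 0 := X2.varpi_ne_zero_of_isNewformOf hf hϖ
  -- data at `W'`
  have hiso' := hiso
  obtain ⟨φ⟩ := hiso'
  obtain ⟨D'⟩ := W'.nonempty_selmerDualData_holds κ γ hγ
  haveI : Module.Finite (IwasawaAlgebra 2) D'.X := D'.module_finite_holds hγ
  obtain ⟨f', hff', hper, hLp⟩ := exists_levelCast hN f
  have hfW' : IsNewformOf W' f := hf.of_isIsogenous hiso.symm_of_charZero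
  have hf' : IsNewformOf W' f' := (hff' W').mpr hfW'
  obtain ⟨ϖ', hϖ'⟩ := exists_varpi_of_isogeny hmod φ hϖ
  have hϖ'' : (ϖ' : ℝ) * W'.realPeriodRat = plusPeriod f' := by rw [hper]; exact hϖ'
  have hϖ'0 : ϖ' ≠ 0 := X2.varpi_ne_zero_of_isNewformOf hfW' hϖ'
  obtain ⟨fX', hfX'⟩ := (charIdeal_isPrincipal_holds 2 D'.X).principal
  have hchar' : D'.charIdeal = Ideal.span {fX'} := hfX'
  -- the Eisenstein clause at `(W', D', f_{X'})`
  have hclause' := hE' κ γ hκ hγ hγ' hord' f' hf' ϖ' hϖ'' D' fX' hchar'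
  -- auxiliary integral slack elements at both members, and the integral `L₂`
  obtain ⟨j, L₀, hL₀0, hL₀⟩ := EisensteinLowerBounds.exists_integral_slack W hord hf hϖ0
  obtain ⟨j', L₀', hL₀'0, hL₀'⟩ := EisensteinLowerBounds.exists_integral_slack W' hord' hf' hϖ'0
  obtain ⟨G, hG⟩ := exists_iwasawaToPowerSeries_eq_padicLFunction_two_auto hord hf
  have hG0 : G ≠ 0 := by
    intro h0
    rw [h0, map_zero] at hG
    exact padicLFunction_unitRoot_ne_zero hord hf hG.symm
  -- the readings at both members (rank-free, Kato only)
  have hB' := (EisensteinLowerBounds.eisensteinAtDatum_iff_lam_le_and_mu_le_slack W' (h17' f') hκ hγ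
    hγ' hord' hf' D' hchar' hL₀'0 hL₀').mp hclause'
  refine (EisensteinLowerBounds.eisensteinAtDatum_iff_lam_le_and_mu_le_slack W (h17 f) hκ hγ hγ' hord
    hf D hchar hL₀0 hL₀).mpr ?_
  -- rescaling data: both `L₀`, `L₀'` are rescalings of `G`
  have hx0 : (((2 : ℚ) ^ j * ϖ : ℚ) : ℚ_[2]) ≠ 0 := by
    exact_mod_cast mul_ne_zero (pow_ne_zero j two_ne_zero) hϖ0
  have hx0' : (((2 : ℚ) ^ j' * ϖ' : ℚ) : ℚ_[2]) ≠ 0 := by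
    exact_mod_cast mul_ne_zero (pow_ne_zero j' two_ne_zero) hϖ'0
  rw [← hG] at hL₀
  rw [hLp, hα, ← hG] at hL₀'
  have hv2 : padicValRat 2 (2 : ℚ) = 1 := by exact_mod_cast padicValRat.self (p := 2) one_lt_two
  have hvx : padicValRat 2 ((2 : ℚ) ^ j * ϖ) = j + padicValRat 2 ϖ := by
    rw [padicValRat.mul (pow_ne_zero j two_ne_zero) hϖ0, padicValRat.pow, hv2, mul_one]
  have hvx' : padicValRat 2 ((2 : ℚ) ^ j' * ϖ') = j' + padicValRat 2 ϖ' := by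
    rw [padicValRat.mul (pow_ne_zero j' two_ne_zero) hϖ'0, padicValRat.pow, hv2, mul_one]
  obtain ⟨-, hμL₀⟩ := mu_eq_of_iwasawaToPowerSeries_eq_C_mul hG0 hL₀0 hx0 hL₀
  obtain ⟨-, hμL₀'⟩ := mu_eq_of_iwasawaToPowerSeries_eq_C_mul hG0 hL₀'0 hx0' hL₀'
  rw [Padic.valuation_ratCast, hvx] at hμL₀
  rw [Padic.valuation_ratCast, hvx'] at hμL₀'
  have hlamL₀ : lam L₀ = lam G := lam_eq_of_iwasawaToPowerSeries_eq_C_mul hG0 hL₀0 hx0 hL₀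
  have hlamL₀' : lam L₀' = lam G := lam_eq_of_iwasawaToPowerSeries_eq_C_mul hG0 hL₀'0 hx0' hL₀'
  -- `λ(X) = λ(X')` and the `μ`-shift law
  have hlamX : D.lambda = D'.lambda := X2.IsogenyLambdaInvariant.lambdaInvariant_eq_of_isIsogenous hiso D D'
  have hshift := mu_add_padicValRat_eq_of_isIsogenous hCassels hiso hEC hEC' hGZK hord hL hκ hγ hγ' hf
    D D' hX hϖ hϖ'
  obtain ⟨hlam', hmu'⟩ := hB'
  refine ⟨?_, ?_⟩
  · rw [hlamL₀, hlamX, ← hlamL₀']; exact hlam'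
  · have h1 : (mu L₀' : ℤ) ≤ D'.mu + j' := by exact_mod_cast hmu'
    have h2 : (mu L₀ : ℤ) ≤ D.mu + j := by linarith
    exact_mod_cast h2

/-- **∀-closed: ITEM 19272's LEAF IS AN ISOGENY-CLASS STATEMENT on K4's rank-`0` domain, granted PUB
(`OrdPublishedInputsAtTwo`, item 19149) + Cassels**: for ℚ-isogenous globally minimal `W ∼ W'`, `W` good
ordinary at `2` of analytic rank `0`, the Eisenstein leaf at `W'` gives the Eisenstein leaf at `W` — no
Kato half, no certificate at `W`. With `katoHalf_isogenyInvariant` / `mazurMainConjecture_two_isogenyInvariant`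
(`…OrdIsogenyTransport`) each of {Kato half, Eisenstein half, `2`-adic MC} is an isogeny-class invariant
there. [cite: SkinnerUrban2014, Conj. 3.6.8 (p. 45) (shape; p odd in print)] [cite: GreenbergLNM1716, §1 p. 64 and §5 p. 175] -/
theorem eisensteinAtTwo_isogenyInvariant (hPub : Literature.Uncategorized.OrdPublishedInputsAtTwo)
    (hCassels : bsdRHS_eq_of_isIsogenous) (hiso : IsIsogenous W W') (hgo : GoodOrd W 2)
    (hr : W.analyticRank = 0) (hE' : O1.MainConjectureEisensteinDivisibilityAtTwo W') :
    O1.MainConjectureEisensteinDivisibilityAtTwo W := by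
  obtain ⟨hmod, hGZK, h17, hGr⟩ := hPub
  exact mainConjectureEisensteinDivisibilityAtTwo_of_isIsogenous hCassels hmod hGZK hiso
    (conductorNorm_eq_of_isIsogenous_of_hasGoodReductionAtPrime_two hiso hgo.1) (fun f ↦ h17 W f)
    (fun f ↦ h17 W' f) (O1.twoAdicEulerCharRankZero_zero_of_greenberg W hGr)
    (O1.twoAdicEulerCharRankZero_zero_of_greenberg W' hGr) hr hE'

/-- **The rank-`0` part of crux `OrdEisensteinHalfAtTwo` from ONE member per isogeny class.** Granted PUB
+ Cassels: if every non-CM good-ordinary-at-`2` curve of analytic rank `0` is ℚ-isogenous to some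
globally minimal curve carrying the Eisenstein leaf, the leaf holds at all of them.
[cite: SkinnerUrban2014, Conj. 3.6.8 (p. 45) (shape; p odd in print)] [cite: GreenbergLNM1716, §1 p. 64 and §5 p. 175] -/
theorem eisensteinAtTwo_rankZero_of_iso (hPub : Literature.Uncategorized.OrdPublishedInputsAtTwo)
    (hCassels : bsdRHS_eq_of_isIsogenous)
    (hβ : ∀ (V : WeierstrassCurve ℚ) [V.IsElliptic] [V.IsGloballyMinimal], ¬ V.HasCM →
      V.analyticRank = 0 → GoodOrd V 2 →
      ∃ (V' : WeierstrassCurve ℚ) (_ : V'.IsElliptic) (_ : V'.IsGloballyMinimal),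
        IsIsogenous V V' ∧ O1.MainConjectureEisensteinDivisibilityAtTwo V') :
    ∀ (V : WeierstrassCurve ℚ) [V.IsElliptic] [V.IsGloballyMinimal], ¬ V.HasCM →
      V.analyticRank = 0 → GoodOrd V 2 → O1.MainConjectureEisensteinDivisibilityAtTwo V := by
  intro V _ _ hcm hr hgo
  obtain ⟨V', _, _, hiso, hE'⟩ := hβ V hcm hr hgo
  exact eisensteinAtTwo_isogenyInvariant hPub hCassels hiso hgo hr hE'

end Eisenstein

end Summit.BirchSwinnertonDyer.BirchSwinnertonDyer.Theorems.IsogenyMuShift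

end
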